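import Mathlib.RingTheory.RootsOfUnity.PrimitiveRoots
import Mathlib.Data.ZMod.Units
import Mathlib.FieldTheory.Finite.Basic
import HarnessLib

/-!
# Discrete-logarithm characters `ψ_ℓ : (ℤ/ℓ)ˣ → ℤ/M` from a recorded root, as DATA-ONLY terms
# (`dlogChar ℓ M η`), with their surjectivity — the `ψ` of the Kurihara twist records (KERNEL tool)

Cell `b2b-bsdres`, supersingular family, prover A = unit `b2b-bsdres-x10b` (gen 12).  Topic file; namespace
`Summit.BirchSwinnertonDyer.Rank1Residual.Supersingular.KuriharaTwist`.  TOOL: three small definitions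
(`powDlogChar`, `dlogChar`, `pairLogs`) + lemmas; no named fact, no elliptic curve, nothing booked.

HONEST FRAMING (run/shared/lean/b2b/bsd-rank1-residual/, verbatim): the goal of the cell is to DELETE the
COMBINATION-SHAPED residual classes of the BSD formula in analytic rank `≤ 1` from PUBLISHED theorems only
and to TYPE the construction-shaped ones; this is not "finishing BSD".

## Why

Every Kurihara-number consumer of the cell (`kuriharaNumber f (p^1) n ψ`, the twist-record chain
`KuriharaTwistRecordAssembly{,Ball,LValues}`) takes the discrete logarithms
`ψ : (ℓ : ℕ) → (ℤ/ℓ)ˣ →* Multiplicative (ℤ/p)` as a PARAMETER, with `hψ : ψ_ℓ` surjective for `ℓ ∣ n`.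
The records fix them by the recorded least primitive roots `η_ℓ` (`TwistRecord.roots`): `ψ_ℓ(η_ℓ) = 1`.  A
per-pair OFFER theorem must therefore NAME such a `ψ` by a closed term containing no proofs.  This file
provides it: `dlogChar ℓ M η` is defined for all `ℓ M η : ℕ` (junk `1` unless the decidable side condition
`DlogData ℓ M η` holds) by `a ↦ log_ζ(a^{(ℓ−1)/M})`, `ζ = η^{(ℓ−1)/M}` a primitive `M`-th root of unity in
`(ℤ/ℓ)ˣ` (Mathlib `IsPrimitiveRoot.zmodEquivZPowers`); `dlogChar_apply_pow_root` (`ψ(η^i) = i`),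
`dlogChar_surjective`; and `pairLogs ℓ₁ ℓ₂ ψ₁ ψ₂` = the family equal to `ψᵢ` at `ℓᵢ` and trivial elsewhere
(`Function.update`), with `surjective_pairLogs_of_mem_primeFactors`.  For a primitive root `η` (the engine's
choice) `dlogChar ℓ M η` is the reduction modulo `M` of `log_η`, i.e. the records' binning convention.

References: HOME/b2b-bsdres-x10b/X6-KURIHARA.md §3 (conventions), §14 (this gen).
-/

namespace Summit.BirchSwinnertonDyer.Rank1Residual.Supersingular.KuriharaTwist

/-! ### §1 The character attached to a primitive `M`-th root of unity `ζ ∈ (ℤ/ℓ)ˣ` -/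

section Pow

variable {ℓ M : ℕ} [Fact ℓ.Prime] [NeZero M]

/-- `a^m` is an `M`-th root of unity when `a^{mM} = 1`, hence a power of the primitive root `ζ`. [folklore] -/
theorem pow_mem_zpowers {ζ : (ZMod ℓ)ˣ} (hζ : IsPrimitiveRoot ζ M) {m : ℕ}
    (hm : ∀ a : (ZMod ℓ)ˣ, a ^ (m * M) = 1) (a : (ZMod ℓ)ˣ) : a ^ m ∈ Subgroup.zpowers ζ := by
  rw [hζ.zpowers_eq, mem_rootsOfUnity, ← pow_mul]
  exact hm a

/-- **The `ζ`-logarithm of the `m`-th power**: `a ↦ log_ζ(a^m) ∈ ℤ/M` for a primitive `M`-th root of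
unity `ζ ∈ (ℤ/ℓ)ˣ` and an exponent `m` with `a^{mM} = 1` for all `a` (for `mM = ℓ − 1`: `a^m` lies in
`μ_M = ⟨ζ⟩`), as a homomorphism into `Multiplicative (ℤ/M)`. [folklore] -/
noncomputable def powDlogChar (ζ : (ZMod ℓ)ˣ) (hζ : IsPrimitiveRoot ζ M) (m : ℕ)
    (hm : ∀ a : (ZMod ℓ)ˣ, a ^ (m * M) = 1) : (ZMod ℓ)ˣ →* Multiplicative (ZMod M) where
  toFun a := Multiplicative.ofAdd
    (hζ.zmodEquivZPowers.symm (Additive.ofMul ⟨a ^ m, pow_mem_zpowers hζ hm a⟩))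
  map_one' := by
    have h1 : (⟨(1 : (ZMod ℓ)ˣ) ^ m, pow_mem_zpowers hζ hm 1⟩ : Subgroup.zpowers ζ) = 1 :=
      Subtype.ext (by simp)
    rw [h1, ofMul_one, map_zero, ofAdd_zero]
  map_mul' a b := by
    have hab : (⟨(a * b) ^ m, pow_mem_zpowers hζ hm (a * b)⟩ : Subgroup.zpowers ζ) =
        ⟨a ^ m, pow_mem_zpowers hζ hm a⟩ * ⟨b ^ m, pow_mem_zpowers hζ hm b⟩ :=
      Subtype.ext (by simp [mul_pow])
    rw [hab, ofMul_mul, map_add, ofAdd_add]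

/-- **Value on an element whose `m`-th power is `ζ^i`**: `powDlogChar a = i`. [folklore] -/
theorem powDlogChar_apply_of_pow_eq {ζ : (ZMod ℓ)ˣ} (hζ : IsPrimitiveRoot ζ M) {m : ℕ}
    (hm : ∀ a : (ZMod ℓ)ˣ, a ^ (m * M) = 1) {a : (ZMod ℓ)ˣ} {i : ℕ} (ha : a ^ m = ζ ^ i) :
    powDlogChar ζ hζ m hm a = Multiplicative.ofAdd ((i : ℕ) : ZMod M) := by
  show Multiplicative.ofAdd (hζ.zmodEquivZPowers.symm (Additive.ofMul ⟨a ^ m, _⟩)) = _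
  have h : (⟨a ^ m, pow_mem_zpowers hζ hm a⟩ : Subgroup.zpowers ζ) = ⟨ζ ^ i, ⟨i, by simp⟩⟩ :=
    Subtype.ext ha
  rw [h, hζ.zmodEquivZPowers_symm_apply_pow]

/-- **Surjectivity**: if some `η` has `η^m = ζ` then `powDlogChar` is onto (`η^i ↦ i`). [folklore] -/
theorem powDlogChar_surjective {ζ : (ZMod ℓ)ˣ} (hζ : IsPrimitiveRoot ζ M) {m : ℕ}
    (hm : ∀ a : (ZMod ℓ)ˣ, a ^ (m * M) = 1) {η : (ZMod ℓ)ˣ} (hη : η ^ m = ζ) :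
    Function.Surjective (powDlogChar ζ hζ m hm) := by
  intro x
  refine ⟨η ^ (Multiplicative.toAdd x).val, ?_⟩
  rw [powDlogChar_apply_of_pow_eq hζ hm (i := (Multiplicative.toAdd x).val)
    (by rw [← pow_mul, mul_comm, pow_mul, hη]), ZMod.natCast_zmod_val, ofAdd_toAdd]

end Pow

/-! ### §2 The data-only character `dlogChar ℓ M η` -/

section Data

/-- The decidable side condition under which `dlogChar ℓ M η` is the genuine character: `ℓ` prime, `M ≠ 0`,
`M ∣ ℓ − 1`, `η` prime to `ℓ`, and `ζ = η^{(ℓ−1)/M}` satisfies `ζ^M = 1`, `ζ ≠ 1` (for prime `M`: `ζ` is a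
primitive `M`-th root of unity). [folklore] -/
def DlogData (ℓ M η : ℕ) : Prop :=
  ℓ.Prime ∧ M ≠ 0 ∧ M ∣ ℓ - 1 ∧ Nat.Coprime η ℓ ∧
    ((η : ZMod ℓ) ^ ((ℓ - 1) / M)) ^ M = 1 ∧ (η : ZMod ℓ) ^ ((ℓ - 1) / M) ≠ 1

/-- `DlogData` is decidable (a conjunction of decidable numeric conditions). [folklore] -/
instance (ℓ M η : ℕ) : Decidable (DlogData ℓ M η) := by
  unfold DlogData; infer_instance

/-- The unit `ζ = η^{(ℓ−1)/M}` of `ℤ/ℓ`. [folklore] -/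
def dlogRoot (ℓ M η : ℕ) (h : Nat.Coprime η ℓ) : (ZMod ℓ)ˣ :=
  ZMod.unitOfCoprime η h ^ ((ℓ - 1) / M)

/-- Under `DlogData` with `M` prime, `ζ = η^{(ℓ−1)/M}` is a primitive `M`-th root of unity. [folklore] -/
theorem isPrimitiveRoot_dlogRoot {ℓ M η : ℕ} [Fact M.Prime] (h : DlogData ℓ M η) :
    IsPrimitiveRoot (dlogRoot ℓ M η h.2.2.2.1) M := by
  rw [IsPrimitiveRoot.iff_orderOf]
  refine orderOf_eq_prime ?_ ?_
  · apply Units.ext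
    rw [Units.val_pow_eq_pow_val, dlogRoot, Units.val_pow_eq_pow_val, ZMod.coe_unitOfCoprime, Units.val_one]
    exact h.2.2.2.2.1
  · intro h1
    apply h.2.2.2.2.2
    have := congrArg (fun u : (ZMod ℓ)ˣ => (u : ZMod ℓ)) h1
    simpa [dlogRoot, Units.val_pow_eq_pow_val, ZMod.coe_unitOfCoprime] using this

/-- Under `DlogData`: `a^{((ℓ−1)/M)·M} = 1` for every unit `a` (`((ℓ−1)/M)·M = ℓ − 1`, Fermat). [folklore] -/
theorem pow_div_mul_eq_one {ℓ M η : ℕ} (h : DlogData ℓ M η) (a : (ZMod ℓ)ˣ) :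
    a ^ ((ℓ - 1) / M * M) = 1 := by
  haveI : Fact ℓ.Prime := ⟨h.1⟩
  rw [Nat.div_mul_cancel h.2.2.1]
  exact ZMod.units_pow_card_sub_one_eq_one ℓ a

/-- **THE DISCRETE-LOGARITHM CHARACTER `dlogChar ℓ M η : (ℤ/ℓ)ˣ →* Multiplicative (ℤ/M)`** — a CLOSED
DATA-ONLY TERM (the per-pair theorems name it with three numerals): under the decidable side condition
`DlogData ℓ M η` (and `M` prime) it is `a ↦ log_ζ(a^{(ℓ−1)/M})`, `ζ = η^{(ℓ−1)/M}`; otherwise the trivial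
character.  For a primitive root `η mod ℓ` (the records' `roots`) this is `log_η mod M`: `dlogChar(η) = 1`
(`dlogChar_apply_root`). [folklore] -/
noncomputable def dlogChar (ℓ M η : ℕ) [Fact M.Prime] : (ZMod ℓ)ˣ →* Multiplicative (ZMod M) :=
  if h : DlogData ℓ M η then
    haveI : Fact ℓ.Prime := ⟨h.1⟩
    powDlogChar (dlogRoot ℓ M η h.2.2.2.1) (isPrimitiveRoot_dlogRoot h) ((ℓ - 1) / M)
      (pow_div_mul_eq_one h)
  else 1

variable {ℓ M η : ℕ} [Fact M.Prime]

/-- `dlogChar(η^i) = i`; in particular `dlogChar(η) = 1`. [folklore] -/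
theorem dlogChar_apply_pow_root (h : DlogData ℓ M η) (i : ℕ) :
    dlogChar ℓ M η (ZMod.unitOfCoprime η h.2.2.2.1 ^ i) = Multiplicative.ofAdd ((i : ℕ) : ZMod M) := by
  haveI : Fact ℓ.Prime := ⟨h.1⟩
  rw [dlogChar, dif_pos h]
  exact powDlogChar_apply_of_pow_eq _ _ (by unfold dlogRoot; exact pow_right_comm _ _ _)

/-- `dlogChar(η) = 1 ∈ ℤ/M` (the records' normalisation `ψ_ℓ(η_ℓ) = 1`). [folklore] -/
theorem dlogChar_apply_root (h : DlogData ℓ M η) :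
    dlogChar ℓ M η (ZMod.unitOfCoprime η h.2.2.2.1) = Multiplicative.ofAdd (1 : ZMod M) := by
  have := dlogChar_apply_pow_root h 1
  rwa [pow_one, Nat.cast_one] at this

/-- **`dlogChar ℓ M η` is surjective** under `DlogData ℓ M η` (`η^i ↦ i`). [folklore] -/
theorem dlogChar_surjective (h : DlogData ℓ M η) : Function.Surjective (dlogChar ℓ M η) := by
  haveI : Fact ℓ.Prime := ⟨h.1⟩
  rw [dlogChar, dif_pos h]
  exact powDlogChar_surjective _ _ (η := ZMod.unitOfCoprime η h.2.2.2.1) rfl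

end Data

/-! ### §3 Families indexed by all `ℓ`: two primes -/

section Family

variable {M : ℕ}

/-- The family of characters equal to `ψ₁` at `ℓ₁`, `ψ₂` at `ℓ₂` and trivial elsewhere — the `ψ`
parameter of `kuriharaNumber f (p^1) (ℓ₁ℓ₂) ψ` and of the twist-record consumers. [folklore] -/
noncomputable def pairLogs (ℓ₁ ℓ₂ : ℕ) (ψ₁ : (ZMod ℓ₁)ˣ →* Multiplicative (ZMod M))
    (ψ₂ : (ZMod ℓ₂)ˣ →* Multiplicative (ZMod M)) : (ℓ : ℕ) → (ZMod ℓ)ˣ →* Multiplicative (ZMod M) :=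
  Function.update (Function.update (fun _ => 1) ℓ₁ ψ₁) ℓ₂ ψ₂

variable {ℓ₁ ℓ₂ : ℕ} (ψ₁ : (ZMod ℓ₁)ˣ →* Multiplicative (ZMod M)) (ψ₂ : (ZMod ℓ₂)ˣ →* Multiplicative (ZMod M))

/-- `pairLogs` at `ℓ₂`. [folklore] -/
theorem pairLogs_apply_right : pairLogs ℓ₁ ℓ₂ ψ₁ ψ₂ ℓ₂ = ψ₂ := by
  simp [pairLogs]

/-- `pairLogs` at `ℓ₁` (`ℓ₁ ≠ ℓ₂`). [folklore] -/
theorem pairLogs_apply_left (hne : ℓ₁ ≠ ℓ₂) : pairLogs ℓ₁ ℓ₂ ψ₁ ψ₂ ℓ₁ = ψ₁ := by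
  simp [pairLogs, Function.update_of_ne hne]

/-- **Surjectivity at every prime factor of `ℓ₁ℓ₂`** (distinct primes) from that of `ψ₁`, `ψ₂` — the `hψ`
binder of the twist-record consumers. [folklore] -/
theorem surjective_pairLogs_of_mem_primeFactors (h₁ : ℓ₁.Prime) (h₂ : ℓ₂.Prime) (hne : ℓ₁ ≠ ℓ₂)
    (hψ₁ : Function.Surjective ψ₁) (hψ₂ : Function.Surjective ψ₂) :
    ∀ ℓ ∈ (ℓ₁ * ℓ₂).primeFactors, Function.Surjective (pairLogs ℓ₁ ℓ₂ ψ₁ ψ₂ ℓ) := by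
  intro ℓ hℓ
  rw [Nat.primeFactors_mul h₁.ne_zero h₂.ne_zero, h₁.primeFactors, h₂.primeFactors, Finset.mem_union,
    Finset.mem_singleton, Finset.mem_singleton] at hℓ
  rcases hℓ with rfl | rfl
  · rw [pairLogs_apply_left ψ₁ ψ₂ hne]; exact hψ₁
  · rw [pairLogs_apply_right]; exact hψ₂

/-- Surjectivity at the single prime `ℓ₂` (prime levels `n = ℓ`: use `pairLogs 0 ℓ 1 ψ`). [folklore] -/
theorem surjective_pairLogs_right (hψ₂ : Function.Surjective ψ₂) :
    Function.Surjective (pairLogs ℓ₁ ℓ₂ ψ₁ ψ₂ ℓ₂) := by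
  rw [pairLogs_apply_right]; exact hψ₂

end Family

/-! ### §4 Sanity: the recorded root of `43314b1@5`, level prime `41` (`η = 6`, `(41−1)/5 = 8`) -/

/-- `DlogData 41 5 6` holds (`6^8 ≢ 1`, `6^40 ≡ 1 (mod 41)`): the side condition is `decide`d per row. [folklore] -/
theorem dlogData_sample : DlogData 41 5 6 := by decide

end Summit.BirchSwinnertonDyer.Rank1Residual.Supersingular.KuriharaTwist
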